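import Mathlib.Topology.Sheaves.Flasque
import Mathlib.Topology.Sheaves.SheafCondition.UniqueGluing
import Mathlib.Topology.Sheaves.MayerVietoris
import Mathlib.Topology.NoetherianSpace
import Mathlib.CategoryTheory.Sites.Limits
import Mathlib.CategoryTheory.Sites.Whiskering
import Mathlib.Algebra.Category.Grp.FilteredColimits
import Mathlib.Algebra.Category.Grp.Zero
import Mathlib.CategoryTheory.Limits.ConcreteCategory.Basic
import Mathlib.CategoryTheory.Limits.FunctorCategory.Basic
import Literature.AlgebraicGeometry.Motives.GrothendieckVanishing
import HarnessLib

/-!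
# Filtered colimits of sheaves on a noetherian space are computed sectionwise
# (Hartshorne II, Ex. 1.11) and a filtered colimit of flasque sheaves is flasque (Hartshorne III.2.8)

Topic: `Literature/AlgebraicGeometry/Motives` (support file for `GrothendieckVanishing.lean`, third link
of the chain of results of Hartshorne, *Algebraic Geometry*, II.1/III.2 leading to Grothendieck's
vanishing theorem III.2.7; this file discharges the named facts
`Literature.AlgebraicGeometry.Motives.preservesColimitsOfShape_sheafToPresheaf` (II, Ex. 1.11) and `Literature.AlgebraicGeometry.Motives.isFlasque_colimit` (III.2.8)).

Setting. `X : TopCat.{u}`; sheaves of abelian groups are the objects of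
`Sheaf (Opens.grothendieckTopology X) AddCommGrpCat.{u}` (definitionally `TopCat.Sheaf AddCommGrpCat X`);
`A` is a small filtered category (e.g. a nonempty directed preorder) and `F : A ⥤ Sheaf _ AddCommGrpCat`
a direct system of sheaves.

Main results (all in `namespace Literature`):

* `DirectedColimit.isSheaf_pt` (**Hartshorne II, Ex. 1.11**): if `X` is noetherian, every colimit
  cocone `c` of the system of *presheaves* `F ⋙ sheafToPresheaf` has `c.pt` a sheaf, i.e. the presheaf
  `U ↦ lim→ ℱ_a(U)` is already a sheaf. Proof as suggested by the exercise: every open subset of a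
  noetherian space is quasi-compact (`NoetherianSpace.isCompact`), so a compatible family of sections
  of `lim→ ℱ_a` on a cover `(V_i)` is determined on a finite subcover; finitely many sections are
  represented at a common stage `a` and, after enlarging `a`, become compatible there
  (`DirectedColimit.ι_eq_of_locally_eq`, `DirectedColimit.exists_gluing_finset`, by induction on the
  finite index set, gluing two sections at a time with Mathlib's Mayer–Vietoris square
  `Opens.mayerVietorisSquare`), so they glue in the sheaf `ℱ_a`.
* `isSheaf_colimit_sheafToPresheaf`, `preservesColimitsOfShape_sheafToPresheaf_of_isFiltered`: hence
  `sheafToPresheaf` preserves filtered colimits (the colimit of sheaves is computed sectionwise), and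
  `exists_rep_of_isColimit`, `rep_eq_iff_of_isColimit`: sections of `lim→ ℱ_a` over `U` are germs of
  sections of the `ℱ_a(U)`.
* `isFlasque_of_isColimit` (**Hartshorne III.2.8**): on a noetherian space a filtered colimit of
  flasque sheaves is flasque (restriction maps of `lim→ ℱ_a` are colimits of surjections).
* `preservesColimitsOfShape_sheafToPresheaf_holds`, `isFlasque_colimit_holds`: the named facts of
  `GrothendieckVanishing.lean` (directed preorders as index categories).

## References

* R. Hartshorne, *Algebraic Geometry*, GTM 52, Springer (1977), doi:10.1007/978-1-4757-3849-0,
  II, Ex. 1.11 (p. 67) and III.2, Prop. 2.8 (p. 209). [Hartshorne1977]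
-/

open CategoryTheory Limits Opposite TopologicalSpace

universe u

namespace Literature.AlgebraicGeometry.Motives

namespace DirectedColimit

variable {X : TopCat.{u}} {A : Type u} [SmallCategory A]
  (F : A ⥤ Sheaf (Opens.grothendieckTopology X) AddCommGrpCat.{u})
  {c : Cocone (F ⋙ sheafToPresheaf _ _)}

/-- Restriction commutes with the transition maps of a system of sheaves. [folklore] -/
theorem map_res {a b : A} (f : a ⟶ b) {U V : Opens X} (i : V ⟶ U) (t : (F.obj a).obj.obj (op U)) :
    (F.obj b).obj.map i.op ((F.map f).hom.app (op U) t) =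
      (F.map f).hom.app (op V) ((F.obj a).obj.map i.op t) :=
  (NatTrans.naturality_apply (F.map f).hom i.op t).symm

/-- Restriction commutes with the maps to a cocone of the underlying presheaves. [folklore] -/
theorem ι_res (c : Cocone (F ⋙ sheafToPresheaf _ _)) (a : A) {U V : Opens X} (i : V ⟶ U)
    (t : (F.obj a).obj.obj (op U)) :
    c.pt.map i.op ((c.ι.app a).app (op U) t) =
      (c.ι.app a).app (op V) ((F.obj a).obj.map i.op t) :=
  (NatTrans.naturality_apply (c.ι.app a) i.op t).symm

/-- The maps to a cocone are compatible with the transition maps (elementwise). [folklore] -/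
theorem ι_map (c : Cocone (F ⋙ sheafToPresheaf _ _)) {a b : A} (f : a ⟶ b) (U : (Opens X)ᵒᵖ)
    (t : (F.obj a).obj.obj U) :
    (c.ι.app b).app U ((F.map f).hom.app U t) = (c.ι.app a).app U t := by
  have := c.w f
  rw [← this]
  rfl

/-- Transitivity of restriction (elementwise). [folklore] -/
theorem res_res (a : A) {U V W : Opens X} (i : V ⟶ U) (j : W ⟶ V) (t : (F.obj a).obj.obj (op U)) :
    (F.obj a).obj.map j.op ((F.obj a).obj.map i.op t) = (F.obj a).obj.map (j ≫ i).op t := by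
  rw [op_comp, Functor.map_comp]
  rfl

/-- A sheaf of abelian groups has only the zero section over the empty open set. [folklore] -/
theorem eq_zero_of_eq_bot (a : A) {U : Opens X} (hU : U = ⊥) (s : (F.obj a).obj.obj (op U)) : s = 0 :=
  (AddCommGrpCat.subsingleton_of_isZero
    ((TopCat.Sheaf.isTerminalOfEqEmpty (F.obj a) hU).isZero)).elim _ _

variable [IsFiltered A] (hc : IsColimit c)
include hc

/-- Every element of a filtered colimit of abelian groups `lim→ ℱ_a(U)` is represented at some
stage. [folklore] -/
theorem exists_rep (U : (Opens X)ᵒᵖ) (s : c.pt.obj U) :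
    ∃ (a : A) (t : (F.obj a).obj.obj U), (c.ι.app a).app U t = s :=
  Concrete.isColimit_exists_rep ((F ⋙ sheafToPresheaf _ _) ⋙ (evaluation _ _).obj U)
    (isColimitOfPreserves ((evaluation (Opens X)ᵒᵖ AddCommGrpCat.{u}).obj U) hc) s

/-- Two representatives define the same element of the filtered colimit `lim→ ℱ_a(U)` iff they
agree at some later stage. [folklore] -/
theorem rep_eq_iff (U : (Opens X)ᵒᵖ) {a b : A} (t : (F.obj a).obj.obj U)
    (t' : (F.obj b).obj.obj U) :
    (c.ι.app a).app U t = (c.ι.app b).app U t' ↔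
      ∃ (k : A) (f : a ⟶ k) (g : b ⟶ k), (F.map f).hom.app U t = (F.map g).hom.app U t' :=
  Concrete.isColimit_rep_eq_iff_exists ((F ⋙ sheafToPresheaf _ _) ⋙ (evaluation _ _).obj U)
    (isColimitOfPreserves ((evaluation (Opens X)ᵒᵖ AddCommGrpCat.{u}).obj U) hc) t t'

/-- Two sections at possibly different stages with the same image in the colimit become equal at a
common later stage. [folklore] -/
theorem exists_map_eq_of_ι_eq (U : (Opens X)ᵒᵖ) {a b : A} (t : (F.obj a).obj.obj U)
    (t' : (F.obj b).obj.obj U) (h : (c.ι.app a).app U t = (c.ι.app b).app U t') :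
    ∃ (k : A) (f : a ⟶ k) (g : b ⟶ k), (F.map f).hom.app U t = (F.map g).hom.app U t' :=
  (rep_eq_iff F hc U t t').mp h

/-- Separation over a finite cover: two sections at stage `a` whose images in the colimit
presheaf agree on each member of a finite open cover have the same image in the colimit (by
induction on the finite index set, enlarging the stage with `IsFiltered.bowtie` and using the
locality of the sheaves `ℱ_a`). [cite: Hartshorne1977, II Ex. 1.11] -/
theorem ι_eq_of_locally_eq {ι : Type*} (V : ι → Opens X) (T : Finset ι) (a : A)
    (r r' : (F.obj a).obj.obj (op (⨆ i ∈ T, V i)))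
    (h : ∀ i (hi : i ∈ T),
      (c.ι.app a).app (op (V i))
          ((F.obj a).obj.map (homOfLE (le_iSup₂ (f := fun i _ => V i) i hi)).op r) =
        (c.ι.app a).app (op (V i))
          ((F.obj a).obj.map (homOfLE (le_iSup₂ (f := fun i _ => V i) i hi)).op r')) :
    (c.ι.app a).app _ r = (c.ι.app a).app _ r' := by
  classical
  induction T using Finset.induction_on generalizing a with
  | empty =>
    have hbot : (⨆ i ∈ (∅ : Finset ι), V i) = ⊥ := by simp
    rw [eq_zero_of_eq_bot F a hbot r, eq_zero_of_eq_bot F a hbot r']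
  | insert j T hj ih =>
    have hle : (⨆ i ∈ T, V i) ≤ ⨆ i ∈ insert j T, V i :=
      iSup₂_le fun i hi => le_iSup₂ (f := fun i _ => V i) i (Finset.mem_insert_of_mem hi)
    have hj' : V j ≤ ⨆ i ∈ insert j T, V i :=
      le_iSup₂ (f := fun i _ => V i) j (Finset.mem_insert_self j T)
    have h₁ := ih a ((F.obj a).obj.map (homOfLE hle).op r) ((F.obj a).obj.map (homOfLE hle).op r')
      (fun i hi => by
        rw [res_res, res_res]
        exact h i (Finset.mem_insert_of_mem hi))
    have h₂ := h j (Finset.mem_insert_self j T)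
    obtain ⟨k₁, f₁, g₁, e₁⟩ := exists_map_eq_of_ι_eq F hc _ _ _ h₁
    obtain ⟨k₂, f₂, g₂, e₂⟩ := exists_map_eq_of_ι_eq F hc _ _ _ h₂
    obtain ⟨s, α, β, hα, hβ⟩ := IsFiltered.bowtie f₁ f₂ g₁ g₂
    rw [← ι_map F c (f₁ ≫ α), ← ι_map F c (g₁ ≫ α) _ r']
    congr 1
    apply TopCat.Sheaf.eq_of_locally_eq₂ (F.obj s) (homOfLE hj') (homOfLE hle)
    · rw [Finset.iSup_insert]
    · rw [map_res, map_res, hα, hβ, Functor.map_comp, Functor.map_comp]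
      change (F.map β).hom.app _ ((F.map f₂).hom.app _ _) =
        (F.map β).hom.app _ ((F.map g₂).hom.app _ _)
      rw [e₂]
    · rw [map_res, map_res, Functor.map_comp, Functor.map_comp]
      change (F.map α).hom.app _ ((F.map f₁).hom.app _ _) =
        (F.map α).hom.app _ ((F.map g₁).hom.app _ _)
      rw [e₁]

end DirectedColimit

variable {X : TopCat.{u}}

/-- Gluing of two sections of a sheaf of abelian groups which agree on the intersection
(from Mathlib's Mayer–Vietoris square of two opens). [folklore] -/
theorem exists_glue₂ (G : Sheaf (Opens.grothendieckTopology X) AddCommGrpCat.{u}) (U V : Opens X)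
    (u : G.obj.obj (op U)) (v : G.obj.obj (op V))
    (huv : G.obj.map (homOfLE inf_le_left : U ⊓ V ⟶ U).op u =
      G.obj.map (homOfLE inf_le_right : U ⊓ V ⟶ V).op v) :
    ∃ w : G.obj.obj (op (U ⊔ V)), G.obj.map (homOfLE le_sup_left).op w = u ∧
      G.obj.map (homOfLE le_sup_right).op w = v := by
  have h := (Opens.mayerVietorisSquare U V).sheafCondition_of_sheaf
    ((sheafCompose _ (forget AddCommGrpCat.{u})).obj G)
  exact ⟨h.glue u v huv, h.map_f₂₄_op_glue u v huv, h.map_f₃₄_op_glue u v huv⟩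

namespace DirectedColimit

variable {A : Type u} [SmallCategory A]
  (F : A ⥤ Sheaf (Opens.grothendieckTopology X) AddCommGrpCat.{u})
  {c : Cocone (F ⋙ sheafToPresheaf _ _)} [IsFiltered A] (hc : IsColimit c)
include hc

/-- Separation over a finite cover (version with an arbitrary open covered by finitely many
`V i`). [cite: Hartshorne1977, II Ex. 1.11] -/
theorem ι_eq_of_locally_eq' {ι : Type*} (V : ι → Opens X) (T : Finset ι) (W : Opens X)
    (hV : ∀ i ∈ T, V i ≤ W) (hW : W ≤ ⨆ i ∈ T, V i) (a : A) (r r' : (F.obj a).obj.obj (op W))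
    (h : ∀ i (hi : i ∈ T),
      (c.ι.app a).app (op (V i)) ((F.obj a).obj.map (homOfLE (hV i hi)).op r) =
        (c.ι.app a).app (op (V i)) ((F.obj a).obj.map (homOfLE (hV i hi)).op r')) :
    (c.ι.app a).app _ r = (c.ι.app a).app _ r' := by
  obtain rfl : W = ⨆ i ∈ T, V i := le_antisymm hW (iSup₂_le hV)
  exact ι_eq_of_locally_eq F hc V T a r r' h

/-- Gluing over a finite subfamily: a compatible family of sections of the colimit presheaf over
opens `V i` is, on `⨆ i ∈ T, V i` for `T` finite, induced by a single section at some stage (by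
induction on `T`, gluing two sections at a time in some sheaf `ℱ_s`). [cite: Hartshorne1977, II Ex. 1.11] -/
theorem exists_gluing_finset {ι : Type*} (V : ι → Opens X) (sf : ∀ i, c.pt.obj (op (V i)))
    (hsf : ∀ i j, c.pt.map (homOfLE (inf_le_left : V i ⊓ V j ≤ V i)).op (sf i) =
      c.pt.map (homOfLE (inf_le_right : V i ⊓ V j ≤ V j)).op (sf j))
    (T : Finset ι) :
    ∃ (a : A) (t : (F.obj a).obj.obj (op (⨆ i ∈ T, V i))), ∀ i (hi : i ∈ T),
      (c.ι.app a).app (op (V i))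
        ((F.obj a).obj.map (homOfLE (le_iSup₂ (f := fun i _ => V i) i hi)).op t) = sf i := by
  classical
  induction T using Finset.induction_on with
  | empty => exact ⟨IsFiltered.nonempty.some, 0, fun i hi => absurd hi (Finset.notMem_empty i)⟩
  | insert j T hj ih =>
    obtain ⟨a, t, ht⟩ := ih
    obtain ⟨b, tj, htj⟩ := exists_rep F hc (op (V j)) (sf j)
    -- move both sections to the common stage `k`
    have ht' : ∀ i (hi : i ∈ T), (c.ι.app (IsFiltered.max a b)).app (op (V i))
        ((F.obj _).obj.map (homOfLE (le_iSup₂ (f := fun i _ => V i) i hi)).op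
          ((F.map (IsFiltered.leftToMax a b)).hom.app _ t)) = sf i := fun i hi => by
      rw [map_res, ι_map]
      exact ht i hi
    have htj' : (c.ι.app (IsFiltered.max a b)).app (op (V j))
        ((F.map (IsFiltered.rightToMax a b)).hom.app _ tj) = sf j := by
      rw [ι_map]
      exact htj
    generalize (F.map (IsFiltered.leftToMax a b)).hom.app _ t = t' at ht'
    generalize (F.map (IsFiltered.rightToMax a b)).hom.app _ tj = tj' at htj'
    generalize IsFiltered.max a b = k at t' tj' ht' htj'
    clear ht htj t tj
    -- the two sections agree, in the colimit, on `V j ⊓ ⨆ i ∈ T, V i`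
    have hagree : (c.ι.app k).app _
          ((F.obj k).obj.map (homOfLE (inf_le_left : V j ⊓ (⨆ i ∈ T, V i) ≤ V j)).op tj') =
        (c.ι.app k).app _
          ((F.obj k).obj.map (homOfLE (inf_le_right : V j ⊓ (⨆ i ∈ T, V i) ≤ _)).op t') := by
      apply ι_eq_of_locally_eq' F hc (fun i => V j ⊓ V i) T (V j ⊓ ⨆ i ∈ T, V i)
        (fun i hi => le_inf inf_le_left (inf_le_right.trans (le_iSup₂ (f := fun i _ => V i) i hi)))
        (by rw [inf_iSup₂_eq])
      intro i hi
      have hVi : V j ⊓ V i ≤ V j ⊓ ⨆ i ∈ T, V i :=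
        le_inf inf_le_left (inf_le_right.trans (le_iSup₂ (f := fun i _ => V i) i hi))
      rw [res_res, res_res]
      have e₁ : (homOfLE hVi ≫ homOfLE inf_le_left) = homOfLE (inf_le_left : V j ⊓ V i ≤ V j) := rfl
      have e₂ : (homOfLE hVi ≫ homOfLE inf_le_right) = homOfLE (inf_le_right : V j ⊓ V i ≤ V i) ≫
            homOfLE (le_iSup₂ (f := fun i _ => V i) i hi) := rfl
      rw [e₁, e₂, ← res_res, ← ι_res, ← ι_res, htj', ht' i hi]
      exact hsf j i
    obtain ⟨s, φ, ψ, e⟩ := exists_map_eq_of_ι_eq F hc _ _ _ hagree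
    rw [← map_res, ← map_res] at e
    -- glue at stage `s`
    obtain ⟨w, hw₁, hw₂⟩ := exists_glue₂ (F.obj s) (V j) (⨆ i ∈ T, V i) _ _ e
    have heq : (⨆ i ∈ insert j T, V i) = V j ⊔ ⨆ i ∈ T, V i := Finset.iSup_insert j T V
    refine ⟨s, (F.obj s).obj.map (homOfLE heq.le).op w, fun i hi => ?_⟩
    rw [res_res]
    rcases Finset.mem_insert.mp hi with rfl | hi'
    · have e₁ : (homOfLE (le_iSup₂ (f := fun i _ => V i) i hi) ≫ homOfLE heq.le) =
          homOfLE (le_sup_left : V i ≤ V i ⊔ ⨆ i ∈ T, V i) := rfl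
      rw [e₁, hw₁, ι_map, htj']
    · have e₂ : (homOfLE (le_iSup₂ (f := fun i _ => V i) i hi) ≫ homOfLE heq.le) =
          homOfLE (le_iSup₂ (f := fun i _ => V i) i hi') ≫
            homOfLE (le_sup_right : (⨆ i ∈ T, V i) ≤ V j ⊔ ⨆ i ∈ T, V i) := rfl
      rw [e₂, ← res_res, hw₂, map_res, ι_map, ht' i hi']


/-- **Hartshorne II, Ex. 1.11** (core statement): on a noetherian topological space (every open
subset is quasi-compact), the presheaf colimit `U ↦ lim→ ℱ_a(U)` of a filtered system of sheaves of
abelian groups is already a sheaf. [cite: Hartshorne1977, II Ex. 1.11] -/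
theorem isSheaf_pt [NoetherianSpace X] : TopCat.Presheaf.IsSheaf (C := AddCommGrpCat.{u}) c.pt := by
  classical
  rw [TopCat.Presheaf.isSheaf_iff_isSheafUniqueGluing]
  intro ι V sf hsf
  -- a finite subcover of `iSup V`
  obtain ⟨T, hT⟩ := (NoetherianSpace.isCompact ((iSup V : Opens X) : Set X)).elim_finite_subcover
    (fun i => (V i : Set X)) (fun i => (V i).2) (by
      rw [Opens.coe_iSup])
  have hcov : iSup V ≤ ⨆ i ∈ T, V i := by
    intro x hx
    have := hT hx
    simp only [Set.mem_iUnion] at this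
    obtain ⟨i, hi, hx⟩ := this
    exact Opens.mem_iSup.mpr ⟨i, Opens.mem_iSup.mpr ⟨hi, hx⟩⟩
  have hTle : (⨆ i ∈ T, V i) ≤ iSup V := iSup₂_le fun i _ => le_iSup V i
  -- separation for sections of `c.pt` over an open `W` covered by the `V i`, `i ∈ T`
  have hsep : ∀ (W : Opens X) (hVW : ∀ i ∈ T, W ⊓ V i ≤ W) (hW : W ≤ ⨆ i ∈ T, V i)
      (x y : c.pt.obj (op W)),
      (∀ i ∈ T, c.pt.map (homOfLE (inf_le_left : W ⊓ V i ≤ W)).op x =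
        c.pt.map (homOfLE (inf_le_left : W ⊓ V i ≤ W)).op y) → x = y := by
    intro W hVW hW x y hxy
    obtain ⟨a, r, rfl⟩ := exists_rep F hc _ x
    obtain ⟨b, r', rfl⟩ := exists_rep F hc _ y
    rw [← ι_map F c (IsFiltered.leftToMax a b), ← ι_map F c (IsFiltered.rightToMax a b) _ r']
    apply ι_eq_of_locally_eq' F hc (fun i => W ⊓ V i) T W (fun i _ => inf_le_left)
      (by rwa [← inf_iSup₂_eq, le_inf_iff, and_iff_right le_rfl])
    intro i hi
    rw [← ι_res, ← ι_res, ι_map, ι_map]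
    exact hxy i hi
  -- existence of a gluing on the finite subcover, hence on `iSup V`
  obtain ⟨a, t, ht⟩ := exists_gluing_finset F hc V sf hsf T
  refine ⟨c.pt.map (homOfLE hcov).op ((c.ι.app a).app _ t), fun i => ?_, fun y hy => ?_⟩
  · -- it is a gluing: check on the finite cover `V i ⊓ V i'`, `i' ∈ T`, of `V i`
    apply hsep (V i) (fun i' _ => inf_le_left) ((le_iSup V i).trans hcov)
    intro i' hi'
    rw [← ConcreteCategory.comp_apply, ← Functor.map_comp, ← ConcreteCategory.comp_apply,
      ← Functor.map_comp, ← op_comp, ← op_comp]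
    have e₁ : (homOfLE (inf_le_left : V i ⊓ V i' ≤ V i) ≫ Opens.leSupr V i) ≫ homOfLE hcov =
        homOfLE (inf_le_right : V i ⊓ V i' ≤ V i') ≫
          homOfLE (le_iSup₂ (f := fun i _ => V i) i' hi') := rfl
    rw [e₁, op_comp, Functor.map_comp, ConcreteCategory.comp_apply, ι_res, ht i' hi']
    exact (hsf i i').symm
  · -- uniqueness
    apply hsep (iSup V) (fun i _ => inf_le_left) hcov
    intro i hi
    have e₁ : homOfLE (inf_le_left : iSup V ⊓ V i ≤ iSup V) =
        homOfLE (inf_le_right : iSup V ⊓ V i ≤ V i) ≫ Opens.leSupr V i := rfl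
    rw [e₁, op_comp, Functor.map_comp, ConcreteCategory.comp_apply, ConcreteCategory.comp_apply,
      hy i]
    congr 1
    rw [← ConcreteCategory.comp_apply, ← Functor.map_comp, ← op_comp]
    have e₂ : Opens.leSupr V i ≫ homOfLE hcov = homOfLE (le_iSup₂ (f := fun i _ => V i) i hi) := rfl
    rw [e₂, ι_res, ht i hi]


end DirectedColimit

section Consequences

variable {A : Type u} [SmallCategory A] [IsFiltered A]

/-- **Hartshorne II, Ex. 1.11**: on a noetherian topological space, the presheaf colimit
`U ↦ lim→ ℱ_a(U)` of a filtered system of sheaves of abelian groups is a sheaf.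
[cite: Hartshorne1977, II Ex. 1.11] -/
theorem isSheaf_colimit_sheafToPresheaf [NoetherianSpace X]
    (F : A ⥤ Sheaf (Opens.grothendieckTopology X) AddCommGrpCat.{u}) :
    Presheaf.IsSheaf (Opens.grothendieckTopology X) (colimit (F ⋙ sheafToPresheaf _ _)) :=
  DirectedColimit.isSheaf_pt F (colimit.isColimit _)

/-- **Hartshorne II, Ex. 1.11** (functorial form): on a noetherian topological space the forgetful
functor from sheaves of abelian groups to presheaves preserves filtered colimits, i.e. filtered
colimits of sheaves are computed sectionwise. [cite: Hartshorne1977, II Ex. 1.11] -/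
theorem preservesColimitsOfShape_sheafToPresheaf_of_isFiltered [NoetherianSpace X] :
    PreservesColimitsOfShape A
      (sheafToPresheaf (Opens.grothendieckTopology X) AddCommGrpCat.{u}) where
  preservesColimit {F} := by
    -- the presheaf colimit is a sheaf, hence a colimit in sheaves mapping to a colimit
    let c : Cocone F :=
      { pt := ⟨colimit (F ⋙ sheafToPresheaf _ _), isSheaf_colimit_sheafToPresheaf F⟩
        ι := { app := fun a => ⟨colimit.ι (F ⋙ sheafToPresheaf _ _) a⟩
               naturality := fun a b f => by
                 ext : 1
                 change (F.map f).hom ≫ colimit.ι (F ⋙ sheafToPresheaf _ _) b =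
                   colimit.ι (F ⋙ sheafToPresheaf _ _) a ≫ 𝟙 _
                 rw [Category.comp_id]
                 exact colimit.w (F ⋙ sheafToPresheaf _ _) f } }
    have hc : IsColimit ((sheafToPresheaf _ _).mapCocone c) := colimit.isColimit _
    exact preservesColimit_of_preserves_colimit_cocone (isColimitOfReflects _ hc) hc

/-- Sections of a filtered colimit of sheaves of abelian groups on a noetherian space: every
section of the colimit sheaf over `U` comes from a section of some `ℱ_a` over `U`.
[cite: Hartshorne1977, II Ex. 1.11] -/
theorem exists_rep_of_isColimit [NoetherianSpace X]
    (F : A ⥤ Sheaf (Opens.grothendieckTopology X) AddCommGrpCat.{u}) {c : Cocone F}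
    (hc : IsColimit c) (U : (Opens X)ᵒᵖ) (s : c.pt.obj.obj U) :
    ∃ (a : A) (t : (F.obj a).obj.obj U), (c.ι.app a).hom.app U t = s :=
  haveI := preservesColimitsOfShape_sheafToPresheaf_of_isFiltered (X := X) (A := A)
  DirectedColimit.exists_rep F (isColimitOfPreserves (sheafToPresheaf _ _) hc) U s

/-- Sections of a filtered colimit of sheaves of abelian groups on a noetherian space: two
sections of `ℱ_a(U)`, `ℱ_b(U)` with the same image in the colimit sheaf agree in some `ℱ_k(U)`.
[cite: Hartshorne1977, II Ex. 1.11] -/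
theorem rep_eq_iff_of_isColimit [NoetherianSpace X]
    (F : A ⥤ Sheaf (Opens.grothendieckTopology X) AddCommGrpCat.{u}) {c : Cocone F}
    (hc : IsColimit c) (U : (Opens X)ᵒᵖ) {a b : A} (t : (F.obj a).obj.obj U)
    (t' : (F.obj b).obj.obj U) :
    (c.ι.app a).hom.app U t = (c.ι.app b).hom.app U t' ↔
      ∃ (k : A) (f : a ⟶ k) (g : b ⟶ k), (F.map f).hom.app U t = (F.map g).hom.app U t' :=
  haveI := preservesColimitsOfShape_sheafToPresheaf_of_isFiltered (X := X) (A := A)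
  DirectedColimit.rep_eq_iff F (isColimitOfPreserves (sheafToPresheaf _ _) hc) U t t'

/-- **Hartshorne III.2.8**: on a noetherian topological space, a filtered colimit of flasque
sheaves of abelian groups is flasque. [cite: Hartshorne1977, III.2.8] -/
theorem isFlasque_of_isColimit [NoetherianSpace X]
    (F : A ⥤ Sheaf (Opens.grothendieckTopology X) AddCommGrpCat.{u})
    [∀ a, TopCat.Sheaf.IsFlasque (F.obj a)] {c : Cocone F} (hc : IsColimit c) :
    TopCat.Sheaf.IsFlasque c.pt where
  epi {U V} i := by
    rw [AddCommGrpCat.epi_iff_surjective]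
    intro s
    obtain ⟨a, t, rfl⟩ := exists_rep_of_isColimit F hc V s
    obtain ⟨t', rfl⟩ := ((AddCommGrpCat.epi_iff_surjective _).mp
      (TopCat.Presheaf.IsFlasque.epi (F := (F.obj a).obj) i)) t
    exact ⟨(c.ι.app a).hom.app U t', (NatTrans.naturality_apply (c.ι.app a).hom i t').symm⟩

end Consequences


section NamedFacts

/-- **Hartshorne II, Ex. 1.11**, in the form of the named fact
`Literature.AlgebraicGeometry.Motives.preservesColimitsOfShape_sheafToPresheaf` of `GrothendieckVanishing.lean`: on a noetherian
topological space the forgetful functor from sheaves of abelian groups to presheaves preserves colimits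
indexed by nonempty directed preorders. [cite: Hartshorne1977, II Ex. 1.11] -/
theorem preservesColimitsOfShape_sheafToPresheaf_holds : preservesColimitsOfShape_sheafToPresheaf.{u} :=
  fun _X _ _A _ _ _ => preservesColimitsOfShape_sheafToPresheaf_of_isFiltered

/-- **Hartshorne III.2.8**, in the form of the named fact `Literature.AlgebraicGeometry.Motives.isFlasque_colimit` of
`GrothendieckVanishing.lean`: on a noetherian topological space a direct limit of flasque sheaves of
abelian groups is flasque. [cite: Hartshorne1977, III.2.8] -/
theorem isFlasque_colimit_holds : isFlasque_colimit.{u} :=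
  fun _X _ _A _ _ _ F _ _c hc => isFlasque_of_isColimit F hc

end NamedFacts

end Literature.AlgebraicGeometry.Motives
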